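import Literature.Topology.FourManifolds.LeeRasmussenMinMaxProofs
import Literature.Topology.FourManifolds.LeeRasmussenRankProofs
import Literature.Topology.FourManifolds.KhComplexDSquaredProofs
import HarnessLib

/-!
# `s_max = s_min + 2` for knot diagrams: discharge of `leeSMax_eq_leeSMin_add_two`

Sibling proof file of `LeeRasmussen.lean` and `LeeRasmussenMinMaxProofs.lean` (topic
`Literature/Topology/FourManifolds`; D-0014: a named fact `def X : Prop` is discharged as
`theorem X_holds : X`). It closes the named fact
`Literature.Topology.FourManifolds.GaussDiagram.leeSMax_eq_leeSMin_add_two` — **for a Gauss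
diagram realised by a knot, `s_max = s_min + 2`** (J. Rasmussen, *Khovanov homology and the
slice genus*, Invent. Math. 182 (2010), Prop. 3.3) — by assembling results already in the tree:

* `LeeRasmussenMinMaxProofs.leeSMax_eq_leeSMin_add_two_of_finrank` — Prop. 3.3 from Lee's
  rank-two theorem in degree zero (the filtered `ℤ/4`-graded involution argument on `Kh'⁰`;
  Rasmussen (2010), §3.1, Lemma 3.5, Cor. 3.6);
* `LeeRasmussenRankProofs.finrank_leeHomologyZero_eq_two_of_dichotomy` — Lee's theorem
  `dim Kh'⁰ = 2` (Lee (2005), Thm. 4.2) from the merge/split dichotomy of the edges of the cube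
  of resolutions;
* `KhComplexDSquaredProofs.isMergeAt_or_isSplitAt_of_hasGaussDiagram_holds` — the dichotomy for
  realisable diagrams (Gauss's parity condition for regular projections of knots,
  `RegularProjectionParity`, and parity ⇒ dichotomy, `KhResolutionsDichotomyProofs`), the only
  place where planarity enters.

Main results: `leeSMax_eq_leeSMin_add_two_of_dichotomy` (the conditional form, for comparison
with `finrank_leeHomologyZero_eq_two_of_dichotomy` and `rasmussenInvariant_mirror_of_dichotomy`)
and the discharge `leeSMax_eq_leeSMin_add_two_holds`. No definition and no named fact is
introduced.

## References

* J. Rasmussen, *Khovanov homology and the slice genus*, Invent. Math. 182 (2010) 419–447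
  (arXiv:math/0402131), §3.1, Def. 3.1, Prop. 3.3 (`s_max = s_min + 2`), Lemma 3.5, Cor. 3.6.
  [cite: Rasmussen2010, Prop. 3.3]
* E. S. Lee, *An endomorphism of the Khovanov invariant*, Adv. Math. 197 (2005) 554–586,
  Thm. 4.2 (`Kh'` of a knot is `ℚ ⊕ ℚ`, in degree `0`). [cite: Lee2005, Thm. 4.2]
-/

noncomputable section

namespace Literature.Topology.FourManifolds

namespace GaussDiagram

/-- **`s_max = s_min + 2`, reduced to the merge/split dichotomy.** The named fact
`leeSMax_eq_leeSMin_add_two` (Rasmussen (2010), Prop. 3.3) follows from the conclusion of the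
named fact `isMergeAt_or_isSplitAt_of_hasGaussDiagram` of `KhResolutions` (every edge of the cube
of resolutions of a realisable Gauss diagram is a merge or a split), for every Gauss diagram:
Lee's rank-two theorem is `finrank_leeHomologyZero_eq_two_of_dichotomy` (Lee (2005), Thm. 4.2)
and Prop. 3.3 from it is `leeSMax_eq_leeSMin_add_two_of_finrank`. [cite: Rasmussen2010, Prop. 3.3] -/
theorem leeSMax_eq_leeSMin_add_two_of_dichotomy
    (hD : ∀ G : GaussDiagram, isMergeAt_or_isSplitAt_of_hasGaussDiagram (G := G)) :
    leeSMax_eq_leeSMin_add_two :=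
  leeSMax_eq_leeSMin_add_two_of_finrank (finrank_leeHomologyZero_eq_two_of_dichotomy hD)

/-- **Rasmussen's Proposition 3.3 (discharge of the named fact `leeSMax_eq_leeSMin_add_two`).**
For every Gauss diagram `G` realised by a knot, `s_max(G) = s_min(G) + 2`: the greatest and the
least filtration degree of a nonzero class of Lee homology in homological degree `0` differ by
exactly `2`. The merge/split dichotomy for realisable diagrams is
`isMergeAt_or_isSplitAt_of_hasGaussDiagram_holds`; the rest is
`leeSMax_eq_leeSMin_add_two_of_dichotomy`. Rasmussen (2010), Prop. 3.3 (with Lee (2005),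
Thm. 4.2). [cite: Rasmussen2010, Prop. 3.3] -/
theorem leeSMax_eq_leeSMin_add_two_holds : leeSMax_eq_leeSMin_add_two :=
  leeSMax_eq_leeSMin_add_two_of_dichotomy fun G ↦ @isMergeAt_or_isSplitAt_of_hasGaussDiagram_holds G

end GaussDiagram

end Literature.Topology.FourManifolds
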